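import Summits.BirchSwinnertonDyer.BirchSwinnertonDyer.Theorems.ManinLocalTwoThreeTameThreeTorsionCongruence
import Summits.BirchSwinnertonDyer.BirchSwinnertonDyer.Theorems.ManinLocalTwoThreeThreeTorsionIsogenyAscent
import HarnessLib

/-!
# On the tame band at `3` a rational `3`-torsion point ASCENDS unless the curve is of type `III`:
# T3III (an's E-an-112) and NB₃^V have the same content at `9 ∥ N` — the v15 split of `kato_shift_three` is loss-free

Summit `BirchSwinnertonDyer`, route `ManinLocalTwoThree` (cell bsd-f2-manin), deciding crux C3 `ManinPrimeToThreeAtNine`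
(stmt-BirchSwinnertonDyer-22968), line `kato_shift_three`.  Skeleton v14 carried the stub NB₃^V `NoAscendingThreeTorsionOptimal`
(«no `X₀(N)`-optimal `W`, `9 ∣ N`, has a rational point of order `3` on `E♮ = E_{W,1}` whose Vélu `3`-quotient ASCENDS»); p3's
p649622 discharged it on the `III` / `III*` strata WITHOUT optimality, and skeleton v15 (lead p1 gen 7) split the stub into the
Kodaira POSITION LAW T3III (an's row E-an-112 `OptimalRationalThreeTorsionIsTypeIII`: an optimal tame curve carrying a rational
`3`-torsion point is of type `III`) and a wild remainder.  With the congruence theorem of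
`…TameThreeTorsionCongruence.lean` (§4 there) THIS FILE proves:

* `exists_three_velu_three_of_isShortThreeTorsion_of_tame_of_ne_III` — **THE ASCENT**: `W` globally minimal, `9 ∥ N(W)`,
  `ord₃ Δ_min ≠ 3`, `T = (X₁, Y₁)` of order `3` on `E♮` ⟹ some globally minimal `W'` carries `(3⁻⁴A, 3⁻⁶B)` for `T`'s `u = 1`
  Vélu pair (`u(W → W/⟨T⟩) = 3`) — the `ℤ/3`-kernel half of an's local law E-an-109 «on `I₀*`/`Iₙ*` a rational `3`-torsion
  line has `u = 3`» (census 10 432 / 10 432, MEMO-an §66) as a theorem; Kodaira form `…_of_kodairaSymbolAt_eq_Istar`;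
* `exists_three_velu_three_iff_ne_III_of_tame` — **THE DICHOTOMY**: on the tame band a rational `3`-torsion point ascends iff
  the curve is not of type `III` (⟹ is p3's E-an-107 theorem `not_exists_three_velu_three_of_isShortThreeTorsion_of_III`);
* `typeIIILaw_iff_noAscending_tame` — **T3III ⟺ NB₃^V restricted to the tame band**, as statements (both spelled out, both OPEN
  optimality laws): the v15 reshape lost nothing;
* `typeIIILaw_of_noAscendingThreeTorsionOptimal` (T3III ⟸ NB₃^V BY NAME) and `typeIIILaw_of_noConstantKernelAscendingAtNine`
  (T3III ⟸ an's E-an-100₉ `NoConstantKernelAscendingThreeOptimalAtNine` BY NAME, through p648978) — an's Stevens-ledger rows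
  E-an-99 / E-an-100 / E-an-100₉ feed the new tame stub by name.

HONEST FRAMING: local theorems and implications between `c`-free statements; T3III, NB₃^V, E-an-100₉, C3, Manin's conjecture
and BSD are NOT proved.  No definitions, no named facts, no sorry.
References: [SilvermanATAEC1994] IV.9.4 Table 4.1; [DokchitserDokchitser2015LocalInvariants] Table 1 and (†); [Stevens1989] §2;
HOME/MEMO-an.md §66–§67.
-/
set_option linter.dupNamespace false
set_option autoImplicit false

noncomputable section

open scoped Classical

open WeierstrassCurve IsDedekindDomain NumberField Rat.HeightOneSpectrum Polynomial
  Literature.NumberTheory.DiophantineGeometry Literature.NumberTheory.EllipticCurves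
  Literature.NumberTheory.EllipticCurves.ModularForms
  Summit.BirchSwinnertonDyer.Rank1Residual.Additive
  Summit.BirchSwinnertonDyer.Rank1Residual.ManinAdditive
  Summit.BirchSwinnertonDyer.Rank1Residual.ManinAdditive.CuspidalKummer
  Summit.BirchSwinnertonDyer.Rank1Residual.ManinAdditive.CuspidalKummerThree
  Summit.BirchSwinnertonDyer.Rank1Residual.ManinAdditive.ThreeIsogenyKernel

namespace Summit.BirchSwinnertonDyer.BirchSwinnertonDyer.Theorems.ManinLocalTwoThree
/-! ### §5 THE ASCENT, the dichotomy, and the stub equivalence T3III ⟺ NB₃^V on the tame band -/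

/-- **THE ASCENT.**  `W` globally minimal, `9 ∥ N(W)`, `ord₃ Δ_min(W) ≠ 3` (i.e. `W` of type `I₀*`, `Iₙ*` or `III*` at `3`), `T = (X₁, Y₁)`
a rational point of order `3` on `E♮`: the Vélu `3`-quotient of `T` ASCENDS — some globally minimal `W'/ℚ` carries
`(3⁻⁴A, 3⁻⁶B)`, `(A, B) = (1440X₁² − 9c₄, 60480X₁³ − 756c₄X₁ − 27c₆)` (the Néron scalar of `W → W/⟨T⟩` is `u = 3`).  This is the
`ℤ/3`-kernel half of an's local law E-an-109 («on `I₀*`/`Iₙ*` a rational `3`-torsion line has `u = 3`», census 10 432 / 10 432,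
MEMO-an §66) as a theorem, via the congruence criterion (p645684) and §4.
[cite: DokchitserDokchitser2015LocalInvariants, Table 1 and (†)] [cite: SilvermanATAEC1994, IV.9.4 Table 4.1] -/
theorem exists_three_velu_three_of_isShortThreeTorsion_of_tame_of_ne_III (W : WeierstrassCurve ℚ) [W.IsElliptic]
    [W.IsGloballyMinimal] (h9 : 3 ^ 2 ∣ W.conductorNorm ℤ) (h27 : ¬ 3 ^ 3 ∣ W.conductorNorm ℤ)
    (hΔ3 : padicValInt 3 W.minimalDiscriminantInt ≠ 3) {X₁ Y₁ : ℚ} (hT : IsShortThreeTorsion W 1 X₁ Y₁) :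
    ∃ W' : WeierstrassCurve ℚ, W'.IsElliptic ∧ W'.IsGloballyMinimal ∧
      (3 : ℚ) ^ 4 * W'.c₄ = 1440 * X₁ ^ 2 - 9 * W.c₄ ∧
      (3 : ℚ) ^ 6 * W'.c₆ = 60480 * X₁ ^ 3 - 756 * W.c₄ * X₁ - 27 * W.c₆ := by
  obtain ⟨hA, hB⟩ := norm_shortModel_le_one_of_nine_dvd_conductorNorm W h9
  exact exists_isGloballyMinimal_three_velu_three_of_congruence W hA hB hT
    (norm_congruence_le_one_of_isShortThreeTorsion_of_tame_of_ne_III W h9 h27 hΔ3 hT)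

/-- **THE DICHOTOMY on the tame band:** for `W` globally minimal with `9 ∥ N(W)` and a rational `3`-torsion point `T` on `E♮`,
`T`'s Vélu `3`-quotient ascends **iff** `W` is NOT of type `III` at `3` (`ord₃ Δ_min ≠ 3`).  (⟸ §5; ⟹ p3's
`not_exists_three_velu_three_of_isShortThreeTorsion_of_III`, E-an-107: on `III` the `u = 1` Vélu pair is minimal.)
[cite: DokchitserDokchitser2015LocalInvariants, Table 1] [cite: SilvermanATAEC1994, IV.9.4 Table 4.1] -/
theorem exists_three_velu_three_iff_ne_III_of_tame (W : WeierstrassCurve ℚ) [W.IsElliptic] [W.IsGloballyMinimal]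
    (h9 : 3 ^ 2 ∣ W.conductorNorm ℤ) (h27 : ¬ 3 ^ 3 ∣ W.conductorNorm ℤ) {X₁ Y₁ : ℚ} (hT : IsShortThreeTorsion W 1 X₁ Y₁) :
    (∃ W' : WeierstrassCurve ℚ, W'.IsElliptic ∧ W'.IsGloballyMinimal ∧
      (3 : ℚ) ^ 4 * W'.c₄ = 1440 * X₁ ^ 2 - 9 * W.c₄ ∧
      (3 : ℚ) ^ 6 * W'.c₆ = 60480 * X₁ ^ 3 - 756 * W.c₄ * X₁ - 27 * W.c₆) ↔
    padicValInt 3 W.minimalDiscriminantInt ≠ 3 := by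
  constructor
  · intro hex h3
    exact not_exists_three_velu_three_of_isShortThreeTorsion_of_III W h9 h27 h3 hT hex
  · intro hΔ3
    exact exists_three_velu_three_of_isShortThreeTorsion_of_tame_of_ne_III W h9 h27 hΔ3 hT

/-- **A tame `I₀*` / `Iₙ*` curve at `3`: every rational `3`-torsion point of `E♮` ascends** (Kodaira form of §5: `Iₙ*` has
`ord₃ Δ_min = n + 6 ≠ 3` by the tree's tame-type exhaustion `kodairaSymbolAt_placeOf_three_of_nine_dvd_conductorNorm`).
[cite: SilvermanATAEC1994, IV.9.4 Table 4.1] [cite: DokchitserDokchitser2015LocalInvariants, Table 1 and (†)] -/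
theorem exists_three_velu_three_of_isShortThreeTorsion_of_kodairaSymbolAt_eq_Istar (W : WeierstrassCurve ℚ) [W.IsElliptic]
    [W.IsGloballyMinimal] (h9 : 3 ^ 2 ∣ W.conductorNorm ℤ) (h27 : ¬ 3 ^ 3 ∣ W.conductorNorm ℤ) {n : ℕ}
    (hK : W.kodairaSymbolAt (placeOf 3) = .Istar n) {X₁ Y₁ : ℚ} (hT : IsShortThreeTorsion W 1 X₁ Y₁) :
    ∃ W' : WeierstrassCurve ℚ, W'.IsElliptic ∧ W'.IsGloballyMinimal ∧
      (3 : ℚ) ^ 4 * W'.c₄ = 1440 * X₁ ^ 2 - 9 * W.c₄ ∧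
      (3 : ℚ) ^ 6 * W'.c₆ = 60480 * X₁ ^ 3 - 756 * W.c₄ * X₁ - 27 * W.c₆ := by
  refine exists_three_velu_three_of_isShortThreeTorsion_of_tame_of_ne_III W h9 h27 ?_ hT
  rcases padicValInt_three_minimalDiscriminantInt_of_nine_dvd_conductorNorm W h9 h27 with
    ⟨h, -⟩ | ⟨-, h⟩ | ⟨-, h⟩ | ⟨m, -, h, -⟩
  · rw [hK] at h; exact absurd h (by simp)
  · omega
  · omega
  · omega

/-- **NO `3`-torsion ⟸ NO ascent, off `III`:** contrapositive form used by the position laws — a globally minimal `W`, `9 ∥ N(W)`,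
none of whose rational `3`-torsion points ascends, and which carries one, is of type `III` (`ord₃ Δ_min = 3`).
[cite: SilvermanATAEC1994, IV.9.4 Table 4.1] -/
theorem padicValInt_minimalDiscriminantInt_eq_three_of_isShortThreeTorsion_of_not_exists_three_velu_three
    (W : WeierstrassCurve ℚ) [W.IsElliptic] [W.IsGloballyMinimal] (h9 : 3 ^ 2 ∣ W.conductorNorm ℤ)
    (h27 : ¬ 3 ^ 3 ∣ W.conductorNorm ℤ) {X₁ Y₁ : ℚ} (hT : IsShortThreeTorsion W 1 X₁ Y₁)
    (hno : ¬ ∃ W' : WeierstrassCurve ℚ, W'.IsElliptic ∧ W'.IsGloballyMinimal ∧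
      (3 : ℚ) ^ 4 * W'.c₄ = 1440 * X₁ ^ 2 - 9 * W.c₄ ∧
      (3 : ℚ) ^ 6 * W'.c₆ = 60480 * X₁ ^ 3 - 756 * W.c₄ * X₁ - 27 * W.c₆) :
    padicValInt 3 W.minimalDiscriminantInt = 3 := by
  by_contra hΔ3
  exact hno (exists_three_velu_three_of_isShortThreeTorsion_of_tame_of_ne_III W h9 h27 hΔ3 hT)

/-- **THE STUB EQUIVALENCE ON THE TAME BAND: T3III ⟺ NB₃^V|tame.**  The v15 stub 4b^T of line `kato_shift_three` (an's
KODAIRA POSITION LAW T3III = E-an-112 `OptimalRationalThreeTorsionIsTypeIII`, spelled out VERBATIM as the left side) is EQUIVALENT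
to the tame restriction of the v14 stub NB₃^V `NoAscendingThreeTorsionOptimal` (right side: NB₃^V's body with `3² ∣ N(W)`,
`3³ ∤ N(W)` added) — so the reshape v14 → v15 lost nothing.  (⟹: p3's `III` theorem; ⟸: §5.)  Both sides are `c`-free
OPTIMALITY laws and stay OPEN; nothing about C3, Manin's conjecture or BSD is proved. [cite: SilvermanATAEC1994, IV.9.4 Table 4.1] -/
theorem typeIIILaw_iff_noAscending_tame :
    (∀ (W : WeierstrassCurve ℚ) [W.IsElliptic] [W.IsGloballyMinimal] {N : ℕ} [NeZero N]
      (D : ModularParametrizationData W N),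
      (∀ z ∈ D.L.lattice, ∃ w ∈ periodLattice D.f, z = D.c * w) → 9 ∣ N →
      3 ^ 2 ∣ W.conductorNorm ℤ → ¬ 3 ^ 3 ∣ W.conductorNorm ℤ →
        ∀ X₁ Y₁ : ℚ, IsShortThreeTorsion W 1 X₁ Y₁ → padicValInt 3 W.minimalDiscriminantInt = 3) ↔
    (∀ (W : WeierstrassCurve ℚ) [W.IsElliptic] [W.IsGloballyMinimal] {N : ℕ} [NeZero N]
      (D : ModularParametrizationData W N),
      (∀ z ∈ D.L.lattice, ∃ w ∈ periodLattice D.f, z = D.c * w) → 9 ∣ N →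
      3 ^ 2 ∣ W.conductorNorm ℤ → ¬ 3 ^ 3 ∣ W.conductorNorm ℤ →
        ∀ X₁ Y₁ : ℚ, IsShortThreeTorsion W 1 X₁ Y₁ →
        ¬ ∃ W' : WeierstrassCurve ℚ, W'.IsElliptic ∧ W'.IsGloballyMinimal ∧
            (3 : ℚ) ^ 4 * W'.c₄ = 1440 * X₁ ^ 2 - 9 * W.c₄ ∧
            (3 : ℚ) ^ 6 * W'.c₆ = 60480 * X₁ ^ 3 - 756 * W.c₄ * X₁ - 27 * W.c₆) := by
  constructor
  · intro h112 W _ _ N _ D hL h9 h9' h27 X₁ Y₁ hT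
    exact not_exists_three_velu_three_of_isShortThreeTorsion_of_III W h9' h27 (h112 W D hL h9 h9' h27 X₁ Y₁ hT) hT
  · intro hno W _ _ N _ D hL h9 h9' h27 X₁ Y₁ hT
    exact padicValInt_minimalDiscriminantInt_eq_three_of_isShortThreeTorsion_of_not_exists_three_velu_three W h9' h27 hT
      (hno W D hL h9 h9' h27 X₁ Y₁ hT)

/-- **T3III ⟸ NB₃^V** (the v14 stub BY NAME implies the v15 tame stub): `NoAscendingThreeTorsionOptimal` forbids every ascent at
`9 ∣ N`; off type `III` a rational `3`-torsion point would ascend (§5). [cite: SilvermanATAEC1994, IV.9.4 Table 4.1] -/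
theorem typeIIILaw_of_noAscendingThreeTorsionOptimal (h : NoAscendingThreeTorsionOptimal) :
    ∀ (W : WeierstrassCurve ℚ) [W.IsElliptic] [W.IsGloballyMinimal] {N : ℕ} [NeZero N]
      (D : ModularParametrizationData W N),
      (∀ z ∈ D.L.lattice, ∃ w ∈ periodLattice D.f, z = D.c * w) → 9 ∣ N →
      3 ^ 2 ∣ W.conductorNorm ℤ → ¬ 3 ^ 3 ∣ W.conductorNorm ℤ →
        ∀ X₁ Y₁ : ℚ, IsShortThreeTorsion W 1 X₁ Y₁ → padicValInt 3 W.minimalDiscriminantInt = 3 := by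
  intro W _ _ N _ D hL h9 h9' h27 X₁ Y₁ hT
  exact padicValInt_minimalDiscriminantInt_eq_three_of_isShortThreeTorsion_of_not_exists_three_velu_three W h9' h27 hT
    (h W D hL h9 X₁ Y₁ hT)

/-- **T3III ⟸ E-an-100₉** (`ThreeIsogenyKernel.NoConstantKernelAscendingThreeOptimalAtNine`, an's Stevens-ledger row, BY NAME):
through NB₃^V ⟸ E-an-100₉ (`noAscendingThreeTorsionOptimal_of_noConstantKernelAscendingAtNine`, p648978).  So an's rows E-an-99 /
E-an-100 / E-an-100₉ feed the v15 tame stub by name. [cite: Stevens1989, Thm. 2.3 (shape only: the rows are the cell's, implied on paper by Stevens' Conjecture II)] -/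
theorem typeIIILaw_of_noConstantKernelAscendingAtNine (h100 : NoConstantKernelAscendingThreeOptimalAtNine) :
    ∀ (W : WeierstrassCurve ℚ) [W.IsElliptic] [W.IsGloballyMinimal] {N : ℕ} [NeZero N]
      (D : ModularParametrizationData W N),
      (∀ z ∈ D.L.lattice, ∃ w ∈ periodLattice D.f, z = D.c * w) → 9 ∣ N →
      3 ^ 2 ∣ W.conductorNorm ℤ → ¬ 3 ^ 3 ∣ W.conductorNorm ℤ →
        ∀ X₁ Y₁ : ℚ, IsShortThreeTorsion W 1 X₁ Y₁ → padicValInt 3 W.minimalDiscriminantInt = 3 :=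
  typeIIILaw_of_noAscendingThreeTorsionOptimal (noAscendingThreeTorsionOptimal_of_noConstantKernelAscendingAtNine h100)

end Summit.BirchSwinnertonDyer.BirchSwinnertonDyer.Theorems.ManinLocalTwoThree

end
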